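import Literature.NumberTheory.LFunctions.Zhang2022.DetectorEntangledConePSD

/-!
# Zhang (2022), programme F-S3 (cell landau-siegel §E, E-102 head 1): the ANCHOR WINDOW of the entangled cone —
# the CLOSED window `[0,1]` (corner `a = 1` included), every real palette, every shift set

Y. Zhang, *Discrete mean estimates and the Landau–Siegel zero*, arXiv:2211.02515v1 [Zhang2022LandauSiegel] — an
unrefereed manuscript under adjudication. **WHAT THIS IS NOT: not a claim about Theorems 1–2 of arXiv:2211.02515, about
Landau–Siegel zeros, or about Parity. What is proved is a statement about the programme's TYPED OBJECT
`Det.entangledMain` / `Det.ConePSD` / `Det.EdetCone` (the (A)-main-term block form of the det family, registry E-102);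
nothing here asserts that this object IS the main term of any discrete mean of the manuscript. «The programme SEARCHES
and TYPES; no claim about Landau–Siegel zeros, Theorems 1–2 of arXiv:2211.02515 or a repaired Margin232 until a kernel
theorem says so.»**

E-102 head 1 is the tree theorem `Det.conePSD_of_mem_Ioo` / `Det.edetCone_of_Ioo` (`DetectorEntangledConePSD`,
ls-barrier-p2 g4, p496401; SUM-OF-SQUARES route R3a v2): `ConePSD a b` for every anchor `a` in the OPEN window `(0,1)`
and every real palette `b : Fin K → ℝ`. The SOS identity degenerates at the corner `a = 1` (`θ = π/2`: `θ cot θ = 0`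
and the Picone weight `tan(θy)` blows up at `y = 1` — theory desk K1–K3, REF-B1 j266039: at `a = 1` the form is PSD with
a `(K−1)`-dimensional kernel), so the corner is NOT an instance of that proof. It IS, however, a one-line consequence of
the open window and of the CLOSURE STABILITY of the cone row (`Det.EdetCone.of_closure`, `DetectorConeClosure`,
ls-Bmulti-typer-2 g3, p481104: the block form is continuous in `(a, b)` for fixed profiles — Hermite–Genocchi form of
the confluent divided differences — and `[0, ∞)` is closed):

* `edetCone_Icc (B) : EdetCone (Set.Icc 0 1) B` — head 1 on the CLOSED anchor window `[0,1]`, every shift set;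
* `conePSD_of_mem_Icc : a ∈ [0,1] → ConePSD a b` (every `K`, every real palette), the corner **`conePSD_one : ConePSD 1 b`**
  and the degenerate end `conePSD_zero : ConePSD 0 b`;
* `re_entangledMain_nonneg_of_mem_Icc` — the inequality itself: `0 ≤ Re m(a;b;h)` for `a ∈ [0,1]` and every one-sided
  kinked profile vector;
* `edetCone_of_subset_Icc` — every anchor set inside `[0,1]` carries the row; `edetCone_unit_closed : EdetCone [0,1] [0,5]`.

So the kernel window of record for E-102 head 1 in the anchor is `[0,1]` (cell note ls-B-ref-1 g4 SHARP-ANCHOR.md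
fa537d73b51bbd31: for `a ∈ (1,2)` and rank ≥ 2 anchor Gram matrices the cone FAILS — paper lemma with certified
witnesses, num-1 j268266; its kernel form, if booked, is the natural Part 2 of this file). 0 facts, 0 sorry, standard
axioms; nothing re-proved (closure of landed theorems).

References: Y. Zhang, arXiv:2211.02515v1 (2022), Prop 7.1 p.44 with (7.2), (7.19)–(7.21); §8 (8.11)–(8.23).
[cite: Zhang2022LandauSiegel, Prop 7.1 p.44; §8 (8.11)–(8.23)]
-/

noncomputable section

open Complex Real Set

namespace Literature.NumberTheory.LFunctions.Zhang2022

namespace Det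

open Repair

variable {K : ℕ} {a : ℝ}

/-- **E-102 head 1 on the CLOSED anchor window `[0,1]`, every shift set `B`:** closure (`Det.EdetCone.of_closure`,
`closure (0,1) = [0,1]`, `closure univ = univ`) of the open-window theorem `Det.edetCone_of_Ioo univ`, then monotonicity
in the shift set. [cite: Zhang2022LandauSiegel, Prop 7.1 p.44 with (7.2), (7.19)–(7.21), (8.11)–(8.23)] -/
theorem edetCone_Icc (B : Set ℝ) : EdetCone (Set.Icc 0 1) B := by
  have h := (edetCone_of_Ioo (Set.univ : Set ℝ)).of_closure
  rw [closure_Ioo (zero_ne_one : (0:ℝ) ≠ 1), closure_univ] at h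
  exact h.mono le_rfl (Set.subset_univ B)

/-- Every anchor set inside `[0,1]` carries head 1, for every shift set.
[cite: Zhang2022LandauSiegel, Prop 7.1 p.44 with (7.2), (8.11)–(8.23)] -/
theorem edetCone_of_subset_Icc {A : Set ℝ} (hA : A ⊆ Set.Icc 0 1) (B : Set ℝ) : EdetCone A B :=
  (edetCone_Icc B).mono hA le_rfl

/-- **`ConePSD a b` for every anchor `a ∈ [0,1]`** (every `K`, every real palette, no box).
[cite: Zhang2022LandauSiegel, Prop 7.1 p.44 with (7.2), (7.19)–(7.21), (8.11)–(8.23)] -/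
theorem conePSD_of_mem_Icc (ha : a ∈ Set.Icc (0:ℝ) 1) (b : Fin K → ℝ) : ConePSD a b :=
  edetCone_Icc Set.univ K a ha b fun _ => Set.mem_univ _

/-- **THE CORNER `a = 1`: `ConePSD 1 b`** for every real palette — the endpoint of the anchor window where the SOS
identity degenerates (`θ cot θ = 0`), reached by closure. [cite: Zhang2022LandauSiegel, Prop 7.1 p.44 with (7.2), (8.11)–(8.23)] -/
theorem conePSD_one (b : Fin K → ℝ) : ConePSD 1 b :=
  conePSD_of_mem_Icc ⟨zero_le_one, le_rfl⟩ b

/-- The degenerate end `a = 0`: `ConePSD 0 b` (by closure; the anchor weight vanishes there).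
[cite: Zhang2022LandauSiegel, Prop 7.1 p.44 with (7.2), (8.11)–(8.23)] -/
theorem conePSD_zero (b : Fin K → ℝ) : ConePSD 0 b :=
  conePSD_of_mem_Icc ⟨le_rfl, zero_le_one⟩ b

/-- **The inequality itself on the closed window:** `0 ≤ Re m(a;b;h)` for `a ∈ [0,1]`, every real palette and every
one-sided kinked profile vector (`h_j(1) = 0`). [cite: Zhang2022LandauSiegel, Prop 7.1 p.44 with (7.2), (7.19)–(7.21), (8.11)–(8.23)] -/
theorem re_entangledMain_nonneg_of_mem_Icc (ha : a ∈ Set.Icc (0:ℝ) 1) (b : Fin K → ℝ) {h h' : Fin K → ℝ → ℂ}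
    (hh : ∀ j, KinkedProfile (h j) (h' j)) (h1 : ∀ j, h j 1 = 0) : 0 ≤ (entangledMain a b h h').re :=
  conePSD_of_mem_Icc ha b h h' hh h1

/-- … at the corner: `0 ≤ Re m(1;b;h)`. [cite: Zhang2022LandauSiegel, Prop 7.1 p.44 with (7.2), (8.11)–(8.23)] -/
theorem re_entangledMain_nonneg_one (b : Fin K → ℝ) {h h' : Fin K → ℝ → ℂ} (hh : ∀ j, KinkedProfile (h j) (h' j))
    (h1 : ∀ j, h j 1 = 0) : 0 ≤ (entangledMain 1 b h h').re :=
  conePSD_one b h h' hh h1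

/-- The row of record with both boxes CLOSED: `EdetCone [0,1] [0,5]` (⊇ the row of record `EdetCone (0,1) (0,5)`,
`Det.edetCone_unit`). [cite: Zhang2022LandauSiegel, Prop 7.1 p.44 with (7.2), (8.11)–(8.23)] -/
theorem edetCone_unit_closed : EdetCone (Set.Icc 0 1) (Set.Icc 0 5) :=
  edetCone_Icc _

/-- The full premise on the closed anchor window: `EdetPremise [0,1] B` for every shift set `B` (head 2 is box-free,
`Det.monomialConePSD_all`). [cite: Zhang2022LandauSiegel, §2 (2.13), Lemma 2.3 p.6; Prop 7.1 p.44 with (7.2), (8.11)–(8.23)] -/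
theorem edetPremise_Icc (B : Set ℝ) : EdetPremise (Set.Icc 0 1) B :=
  ⟨edetCone_Icc B, monomialConePSD_all B⟩


/-! ### v2 append — the half-open spellings asked by KNIFE-EDGES §4 (theory g3 2026-08-27T04:42:45Z): window of record
`(0,1]` in the anchor -/

/-- **E-102 head 1 on the window of record `(0,1]`** (corner included), every shift set.
[cite: Zhang2022LandauSiegel, Prop 7.1 p.44 with (7.2), (8.11)–(8.23)] -/
theorem edetCone_Ioc (B : Set ℝ) : EdetCone (Set.Ioc 0 1) B :=
  edetCone_of_subset_Icc Set.Ioc_subset_Icc_self B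

/-- The KNIFE-EDGES row spelling: `EdetCone (0,1] (0,5)`. [cite: Zhang2022LandauSiegel, Prop 7.1 p.44 with (7.2), (8.11)–(8.23)] -/
theorem edetCone_Ioc_unit : EdetCone (Set.Ioc 0 1) (Set.Ioo 0 5) :=
  edetCone_Ioc _

/-- `ConePSD a b` for `a ∈ (0,1]`. [cite: Zhang2022LandauSiegel, Prop 7.1 p.44 with (7.2), (8.11)–(8.23)] -/
theorem conePSD_of_mem_Ioc (ha : a ∈ Set.Ioc (0:ℝ) 1) (b : Fin K → ℝ) : ConePSD a b :=
  conePSD_of_mem_Icc (Set.Ioc_subset_Icc_self ha) b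

/-- The full premise on `(0,1]`: `EdetPremise (0,1] B`. [cite: Zhang2022LandauSiegel, §2 Lemma 2.3 p.6; Prop 7.1 p.44 with (7.2)] -/
theorem edetPremise_Ioc (B : Set ℝ) : EdetPremise (Set.Ioc 0 1) B :=
  ⟨edetCone_Ioc B, monomialConePSD_all B⟩

end Det

end Literature.NumberTheory.LFunctions.Zhang2022
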